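import HarnessLib
import Summits.Langlands.Langlands.Theses.SkinnerWilesDefectOne
import Summits.Langlands.Langlands.Theorems.BianchiCongruenceCohomologyFinite.Negative.FalseWithoutFinite
import Literature.NumberTheory.Automorphic.ArithmeticQuotientCohomologyFiniteProofs
import Mathlib.NumberTheory.NumberField.Cyclotomic.Basic

/-!
# `BianchiCongruenceCohomologyFinite` (stmt-Langlands-15362) — Negative knowledge: no vanishing
# above the virtual cohomological dimension; torsion classes in every degree

Crux-disprover lemmas (cdisprove, 2026-08-16) for the crux
`∀ K imaginary quadratic, ∀ U ≤ GL₂(𝔸_K^∞) compact open, ∀ A : Rep ℤ (GL₂(K) ∩ U) finite, ∀ q,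
Finite (groupCohomology A q)` (Borel–Serre finiteness; a theorem in print, no `¬`-theorem of the
crux itself is expected).  The crux rightly asks for FINITENESS IN EVERY DEGREE and not for
vanishing in large degree: the two natural strengthenings

* "`H^q(Γ_U, A) = 0` for `q > 2 = vcd` (the Bianchi orbifold `Γ_U \ ℍ³` has a 2-dimensional
  spine)" — `not_bianchiCongruenceCohomology_subsingleton_above_two`, and
* "`H^q(Γ_U, A) = 0` for all large `q`" (equivalently: `Γ_U` has finite cohomological dimension
  over `ℤ`, e.g. `ℤ` admits a finite-length projective `ℤ[Γ_U]`-resolution) —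
  `not_bianchiCongruenceCohomology_eventually_subsingleton`

are FALSE as typed, already at the non-vacuity witness of the route: `K = ℚ(ζ₃)`,
`U = GL₂(𝒪̂_K)` (compact open), `Γ_U = GL₂(𝓞_K)`, `A = ℤ/2` trivial —
`nontrivial_groupCohomology_glIntegers_cyclotomicField_three : ∀ q, H^q(GL₂(𝓞_K), ℤ/2) ≠ 0`.
Mechanism (torsion): `C₂ = ⟨diag(-1, 1)⟩` is a RETRACT of `GL₂(𝓞_K)` — the retraction is
`γ ↦ det γ mod (ζ₃ - 1) ∈ (𝓞_K/(ζ₃ - 1))ˣ = 𝔽₃ˣ = {±1}`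
(`nonempty_ringHom_ringOfIntegers_cyclotomicField_three_zmod_three`, `exists_retract_glTwo_of_ringHom`)
— so `H^q(C₂, 𝔽₂) = 𝔽₂ ≠ 0` (Mathlib `Rep.FiniteCyclicGroup.groupCohomologyπOdd/Even`,
`nontrivial_groupCohomology_cyclic_two`) injects into `H^q(GL₂(𝓞_K), 𝔽₂)` for EVERY `q`
(`nontrivial_groupCohomology_trivial_of_retract`: `i^* ∘ r^* = id` by `groupCohomology.map_comp`,
`map_congr`, `map_id`).

Consequence for provers: `Γ_U` itself is NOT of type (FL)/(FP) with finite `cd` whenever it has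
`2`-torsion (every `U ∋ diag(-1,1)`, in particular `GL₂(𝒪̂_K)` and every `U` containing the
centre `±1`); a finite-type resolution can only exist for a TORSION-FREE finite-index subgroup
(`Γ(𝔫)`, `N𝔫 ≥ 3`, in-tree `NumberFields.GeneralLinearGroup.exists_finiteIndex_forall_isOfFinOrder_eq_one`),
and finiteness must then ASCEND along the finite index (in-tree
`Literature.Algebra.Homology.finite_groupCohomology_of_finiteIndex`, Shapiro + dimension shifting) —
exactly the shape of the in-tree reduction
`BorelSerre1973_finite_groupCohomology_congruenceSubgroup_of_typeFL_torsionFree`; a resolution of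
finite length for `Γ_U` itself, or a vanishing lemma above degree `2`, cannot be an intermediate
step.  No statement of the route is used or asserted. [folklore]
-/

set_option linter.dupNamespace false -- project-wide option (lakefile weak.linter.dupNamespace); `Summit.Langlands.Langlands` is the mandated namespace

noncomputable section

open CategoryTheory NumberField
open Literature.NumberTheory.Automorphic

namespace Summit.Langlands.Langlands.Theorems.BianchiCongruenceCohomologyFinite.Negative

universe u

/-! ### `H^q(C₂, 𝔽₂) ≠ 0` in every degree -/

/-- `C₂ = Multiplicative (ZMod 2)` is generated by `ofAdd 1`. [folklore] -/
theorem multiplicative_zmod_two_mem_zpowers :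
    ∀ x : Multiplicative (ZMod 2), x ∈ Subgroup.zpowers (Multiplicative.ofAdd (1 : ZMod 2)) := by
  intro x
  have hx : x = 1 ∨ x = Multiplicative.ofAdd (1 : ZMod 2) := by revert x; decide
  rcases hx with rfl | rfl
  · exact Subgroup.one_mem _
  · exact Subgroup.mem_zpowers _

/-- The norm map `N = ∑_{g ∈ C₂} ρ(g) = 2 = 0` of the trivial `C₂`-module `ℤ/2`. [folklore] -/
theorem norm_trivial_cyclic_two_apply (x : ZMod 2) :
    (Rep.Hom.hom (Rep.trivial ℤ (Multiplicative (ZMod 2)) (ZMod 2)).norm) x = 0 := by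
  rw [Rep.norm_apply]
  change (∑ g : Multiplicative (ZMod 2),
    ((Rep.trivial ℤ (Multiplicative (ZMod 2)) (ZMod 2)).ρ g)) x = 0
  rw [LinearMap.sum_apply]
  change ∑ d : Multiplicative (ZMod 2), (x : ZMod 2) = (0 : ZMod 2)
  revert x
  decide

/-- `ρ(g) - 1 = 0` on the trivial `C₂`-module `ℤ/2`. [folklore] -/
theorem applyAsHom_sub_id_trivial_cyclic_two_apply (x : ZMod 2) :
    (Rep.Hom.hom ((Rep.trivial ℤ (Multiplicative (ZMod 2)) (ZMod 2)).applyAsHom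
      (Multiplicative.ofAdd (1 : ZMod 2)) - 𝟙 (Rep.trivial ℤ (Multiplicative (ZMod 2)) (ZMod 2)))) x
      = 0 := by
  rw [Rep.sub_hom]
  change x - x = (0 : ZMod 2)
  exact sub_self x

/-- **`H^q(C₂, ℤ/2) ≠ 0` for every `q ≥ 0`** (trivial action): by Mathlib's computation of the
cohomology of finite cyclic groups (`Rep.FiniteCyclicGroup.groupCohomologyπOdd/Even`), `H^q` is
`ker N / im(ρ(g) - 1) = (ℤ/2)/0` for `q` odd and `ker(ρ(g) - 1)/im N = (ℤ/2)/0` for `q > 0` even,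
and `H⁰ = ℤ/2`. [folklore] -/
theorem nontrivial_groupCohomology_cyclic_two (q : ℕ) :
    Nontrivial (groupCohomology (Rep.trivial ℤ (Multiplicative (ZMod 2)) (ZMod 2)) q) := by
  have hg := multiplicative_zmod_two_mem_zpowers
  rcases Nat.even_or_odd q with hq | hq
  · rcases Nat.eq_zero_or_pos q with rfl | hpos
    · have e := (groupCohomology.H0IsoOfIsTrivial
        (Rep.trivial ℤ (Multiplicative (ZMod 2)) (ZMod 2))).toLinearEquiv
      haveI : Nontrivial (ModuleCat.of ℤ (Rep.trivial ℤ (Multiplicative (ZMod 2)) (ZMod 2)).V) :=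
        inferInstanceAs (Nontrivial (ZMod 2))
      exact e.toEquiv.nontrivial
    · haveI : NeZero q := ⟨hpos.ne'⟩
      let x : LinearMap.ker (Rep.Hom.hom ((Rep.trivial ℤ (Multiplicative (ZMod 2)) (ZMod 2)).applyAsHom
          (Multiplicative.ofAdd (1 : ZMod 2)) -
            𝟙 (Rep.trivial ℤ (Multiplicative (ZMod 2)) (ZMod 2)))).toLinearMap :=
        ⟨((1 : ZMod 2) : (Rep.trivial ℤ (Multiplicative (ZMod 2)) (ZMod 2)).V), by
          rw [LinearMap.mem_ker]; exact applyAsHom_sub_id_trivial_cyclic_two_apply 1⟩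
      have hx : Rep.FiniteCyclicGroup.groupCohomologyπEven
          (Rep.trivial ℤ (Multiplicative (ZMod 2)) (ZMod 2)) _ hg q hq x ≠ 0 := by
        rw [Ne, Rep.FiniteCyclicGroup.groupCohomologyπEven_eq_zero_iff]
        rintro ⟨y, hy⟩
        have h0 := norm_trivial_cyclic_two_apply y
        have h1 : (Rep.Hom.hom (Rep.trivial ℤ (Multiplicative (ZMod 2)) (ZMod 2)).norm) y
            = (1 : ZMod 2) := hy
        rw [h0] at h1
        exact (by decide : (0 : ZMod 2) ≠ 1) h1
      exact ⟨⟨_, 0, hx⟩⟩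
  · let x : LinearMap.ker
        (Rep.Hom.hom (Rep.trivial ℤ (Multiplicative (ZMod 2)) (ZMod 2)).norm).toLinearMap :=
      ⟨((1 : ZMod 2) : (Rep.trivial ℤ (Multiplicative (ZMod 2)) (ZMod 2)).V), by
        rw [LinearMap.mem_ker]; exact norm_trivial_cyclic_two_apply 1⟩
    have hx : Rep.FiniteCyclicGroup.groupCohomologyπOdd
        (Rep.trivial ℤ (Multiplicative (ZMod 2)) (ZMod 2)) _ hg q hq x ≠ 0 := by
      rw [Ne, Rep.FiniteCyclicGroup.groupCohomologyπOdd_eq_zero_iff]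
      rintro ⟨y, hy⟩
      have h0 := applyAsHom_sub_id_trivial_cyclic_two_apply y
      have h1 : (Rep.Hom.hom ((Rep.trivial ℤ (Multiplicative (ZMod 2)) (ZMod 2)).applyAsHom
          (Multiplicative.ofAdd (1 : ZMod 2)) -
            𝟙 (Rep.trivial ℤ (Multiplicative (ZMod 2)) (ZMod 2)))) y = (1 : ZMod 2) := hy
      rw [h0] at h1
      exact (by decide : (0 : ZMod 2) ≠ 1) h1
    exact ⟨⟨_, 0, hx⟩⟩

/-! ### Trivial-coefficient cohomology detects retracts -/

/-- **Cohomology with trivial coefficients detects retracts**: if `H` is a retract of `G`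
(`i : H → G`, `r : G → H`, `r ∘ i = id`) then `Hⁿ(H, V) ≠ 0 ⇒ Hⁿ(G, V) ≠ 0` for every trivial
coefficient module `V`: `i^* ∘ r^* = (r ∘ i)^* = id` (`groupCohomology.map_comp`, `map_congr`,
`map_id`), so `r^* : Hⁿ(H, V) → Hⁿ(G, V)` is injective. [folklore] -/
theorem nontrivial_groupCohomology_trivial_of_retract {k : Type u} [CommRing k] {G H : Type u}
    [Group G] [Group H] (i : H →* G) (r : G →* H) (hri : r.comp i = MonoidHom.id H)
    (V : Type u) [AddCommGroup V] [Module k V] (n : ℕ)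
    [Nontrivial (groupCohomology (Rep.trivial k H V) n)] :
    Nontrivial (groupCohomology (Rep.trivial k G V) n) := by
  -- the identity of `V` as morphisms `Res_r(V_H) ⟶ V_G` and `Res_i(V_G) ⟶ V_H`
  let φ : Rep.res r (Rep.trivial k H V) ⟶ Rep.trivial k G V := Rep.ofHom ⟨LinearMap.id, fun _ => rfl⟩
  let ψ : Rep.res i (Rep.trivial k G V) ⟶ Rep.trivial k H V := Rep.ofHom ⟨LinearMap.id, fun _ => rfl⟩
  have hcomp : groupCohomology.map r φ n ≫ groupCohomology.map i ψ n = 𝟙 _ := by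
    rw [← groupCohomology.map_comp,
      groupCohomology.map_congr (f := r.comp i) (g := MonoidHom.id H) (A := Rep.trivial k H V)
        (φ := (Rep.resFunctor i).map φ ≫ ψ) (ψ := 𝟙 (Rep.trivial k H V)) hri rfl n,
      groupCohomology.map_id]
  have hleft : Function.LeftInverse (groupCohomology.map i ψ n) (groupCohomology.map r φ n) := by
    intro x
    have h := congrArg (fun f => (ModuleCat.Hom.hom f) x) hcomp
    simpa using h
  exact hleft.injective.nontrivial

/-! ### The retract `C₂ = ⟨diag(-1, 1)⟩` of `GL₂(R)` through `det mod 𝔭`, `R/𝔭 = 𝔽₃` -/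

/-- **A retract pair `C₂ → GL₂(R) → C₂`** for any commutative ring `R` with a ring homomorphism
`π : R → ℤ/3`: `i(g) = diag(-1, 1)` (order `2`, built with `ZMod.lift`) and
`r(γ) = χ(π(det γ))` with `χ : (ℤ/3)ˣ = {±1} ≅ C₂`; `r(i(g)) = χ(π(-1)) = χ(-1) = g`. [folklore] -/
theorem exists_retract_glTwo_of_ringHom {R : Type} [CommRing R] (π : R →+* ZMod 3) :
    ∃ (i : Multiplicative (ZMod 2) →* GL (Fin 2) R) (r : GL (Fin 2) R →* Multiplicative (ZMod 2)),
      r.comp i = MonoidHom.id _ := by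
  -- the quadratic character `(ℤ/3)ˣ = {±1} → C₂`
  let χ : (ZMod 3)ˣ →* Multiplicative (ZMod 2) :=
    MonoidHom.mk' (fun u => if u = 1 then 1 else Multiplicative.ofAdd 1) (by decide)
  let r : GL (Fin 2) R →* Multiplicative (ZMod 2) :=
    χ.comp ((Units.map π.toMonoidHom).comp Matrix.GeneralLinearGroup.det)
  -- the element `c = diag(-1, 1)` of order `2`
  let c : GL (Fin 2) R := glDiagonal 2 R ![-1, 1]
  have hcc : c * c = 1 := by
    rw [← map_mul, ← map_one (glDiagonal 2 R)]
    congr 1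
    ext i
    fin_cases i <;> simp
  have h2c : (zmultiplesHom (Additive (GL (Fin 2) R)) (Additive.ofMul c)) 2 = 0 := by
    rw [zmultiplesHom_apply, two_zsmul, ← ofMul_mul, hcc, ofMul_one]
  let i : Multiplicative (ZMod 2) →* GL (Fin 2) R :=
    AddMonoidHom.toMultiplicativeLeft (ZMod.lift 2 ⟨_, h2c⟩)
  have hi : i (Multiplicative.ofAdd 1) = c := by
    simp only [i, AddMonoidHom.coe_toMultiplicativeLeft, Function.comp_apply, toAdd_ofAdd]
    rw [show (1 : ZMod 2) = ((1 : ℤ) : ZMod 2) from (Int.cast_one).symm, ZMod.lift_coe]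
    simp
  have hdet : Matrix.GeneralLinearGroup.det c = -1 := by
    refine Units.ext ?_
    rw [Matrix.GeneralLinearGroup.val_det_apply, coe_glDiagonal, Matrix.det_diagonal,
      Fin.prod_univ_two]
    simp
  have hπ : Units.map π.toMonoidHom (-1 : Rˣ) = -1 := Units.ext (by simp)
  have hri : r (i (Multiplicative.ofAdd 1)) = Multiplicative.ofAdd 1 := by
    rw [hi]
    simp only [r, MonoidHom.coe_comp, Function.comp_apply, hdet, hπ]
    decide
  refine ⟨i, r, MonoidHom.ext fun x => ?_⟩
  have hx : x = 1 ∨ x = Multiplicative.ofAdd (1 : ZMod 2) := by revert x; decide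
  rcases hx with rfl | rfl
  · simp
  · simpa using hri

/-- **There is a ring homomorphism `𝓞_{ℚ(ζ₃)} → ℤ/3`**: reduction modulo the (ramified) prime
`𝔭 = (ζ₃ - 1)`, whose residue ring has `|N_{K/ℚ}(ζ₃ - 1)| = 3` elements
(`IsPrimitiveRoot.card_quotient_toInteger_sub_one`, `norm_toInteger_sub_one_of_prime_ne_two'`),
hence is `ℤ/3` (`ZMod.ringEquivOfPrime`). [folklore] -/
theorem nonempty_ringHom_ringOfIntegers_cyclotomicField_three_zmod_three :
    Nonempty (𝓞 (CyclotomicField 3 ℚ) →+* ZMod 3) := by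
  obtain ⟨A, hA⟩ : ∃ A : Algebra ℚ (CyclotomicField 3 ℚ),
      @IsCyclotomicExtension {3} ℚ (CyclotomicField 3 ℚ) _ _ A :=
    ⟨_, CyclotomicField.isCyclotomicExtension 3 ℚ⟩
  have hAeq : A = (DivisionRing.toRatAlgebra : Algebra ℚ (CyclotomicField 3 ℚ)) :=
    Subsingleton.elim _ _
  subst hAeq
  haveI := hA
  have hζ := IsCyclotomicExtension.zeta_spec 3 ℚ (CyclotomicField 3 ℚ)
  set 𝔭 : Ideal (𝓞 (CyclotomicField 3 ℚ)) := Ideal.span {hζ.toInteger - 1} with h𝔭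
  haveI : Finite (𝓞 (CyclotomicField 3 ℚ) ⧸ 𝔭) := hζ.finite_quotient_toInteger_sub_one (by norm_num)
  letI : Fintype (𝓞 (CyclotomicField 3 ℚ) ⧸ 𝔭) := Fintype.ofFinite _
  have hcard : Fintype.card (𝓞 (CyclotomicField 3 ℚ) ⧸ 𝔭) = 3 := by
    rw [← Nat.card_eq_fintype_card, h𝔭, hζ.card_quotient_toInteger_sub_one,
      hζ.norm_toInteger_sub_one_of_prime_ne_two' (by decide)]
    rfl
  exact ⟨(ZMod.ringEquivOfPrime _ Nat.prime_three hcard).symm.toRingHom.comp (Ideal.Quotient.mk 𝔭)⟩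

/-! ### Torsion classes in every degree for `GL₂(𝓞_{ℚ(ζ₃)})` -/

/-- **`H^q(GL₂(𝓞_K), ℤ/2) ≠ 0` for every `q ≥ 0`, `K = ℚ(ζ₃)`**, the group being written as the
congruence subgroup `Γ_U = GL₂(K) ∩ GL₂(𝒪̂_K)` of the compact open level `U = GL₂(𝒪̂_K)` of the
crux (`= GL₂(𝓞_K)`: in-tree `BigHeckeGLn.comap_glFiniteIntegralLevel_globalEmbedding`,
`map_algebraMap_ringOfIntegers_injective`): `C₂ = ⟨diag(-1,1)⟩` is a retract of it
(`exists_retract_glTwo_of_ringHom` with `nonempty_ringHom_ringOfIntegers_cyclotomicField_three_zmod_three`)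
and `H^q(C₂, ℤ/2) ≠ 0` (`nontrivial_groupCohomology_cyclic_two`,
`nontrivial_groupCohomology_trivial_of_retract`).  So the Bianchi group `GL₂(𝓞_K)` has
`2`-torsion cohomology in EVERY degree: it is not of finite cohomological dimension over `ℤ`.
[folklore] -/
theorem nontrivial_groupCohomology_glIntegers_cyclotomicField_three (q : ℕ) :
    Nontrivial (groupCohomology (Rep.trivial ℤ
      ((glFiniteIntegralLevel 2 (CyclotomicField 3 ℚ)).comap
        (BigHeckeGLn.globalEmbedding 2 (CyclotomicField 3 ℚ))) (ZMod 2)) q) := by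
  obtain ⟨π⟩ := nonempty_ringHom_ringOfIntegers_cyclotomicField_three_zmod_three
  obtain ⟨i₀, r₀, h₀⟩ := exists_retract_glTwo_of_ringHom π
  have hΓ := BigHeckeGLn.comap_glFiniteIntegralLevel_globalEmbedding 2 (CyclotomicField 3 ℚ)
  let e : ((glFiniteIntegralLevel 2 (CyclotomicField 3 ℚ)).comap
      (BigHeckeGLn.globalEmbedding 2 (CyclotomicField 3 ℚ))) ≃* GL (Fin 2) (𝓞 (CyclotomicField 3 ℚ)) :=
    (MulEquiv.subgroupCongr hΓ).trans (MonoidHom.ofInjective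
      (BigHeckeGLn.map_algebraMap_ringOfIntegers_injective 2 (CyclotomicField 3 ℚ))).symm
  have hri : (r₀.comp e.toMonoidHom).comp (e.symm.toMonoidHom.comp i₀) = MonoidHom.id _ :=
    MonoidHom.ext fun x => by simpa using DFunLike.congr_fun h₀ x
  haveI := nontrivial_groupCohomology_cyclic_two q
  exact nontrivial_groupCohomology_trivial_of_retract (e.symm.toMonoidHom.comp i₀)
    (r₀.comp e.toMonoidHom) hri (ZMod 2) q

/-! ### The refuted strengthenings of the crux -/

/-- **No vanishing above the virtual cohomological dimension.**  The strengthening of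
`BianchiCongruenceCohomologyFinite` replacing "finite in every degree" by "zero in degrees
`q > 2 = vcd(Γ_U)`" is FALSE: `K = ℚ(ζ₃)`, `U = GL₂(𝒪̂_K)` (compact open), `A = ℤ/2` trivial
(finite), `q = 3`, `H³(GL₂(𝓞_K), ℤ/2) ≠ 0` (`nontrivial_groupCohomology_glIntegers_cyclotomicField_three`).
Torsion in `Γ_U` is the obstruction; vanishing above `2` holds only for torsion-free `Γ_U`.
[folklore] -/
theorem not_bianchiCongruenceCohomology_subsingleton_above_two :
    ¬ ∀ (K : Type) [Field K] [NumberField K], Module.finrank ℚ K = 2 → IsTotallyComplex K →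
        ∀ (U : Subgroup (BigHeckeGLn.FiniteAdelicGL 2 K)),
          IsOpen (U : Set (BigHeckeGLn.FiniteAdelicGL 2 K)) →
          IsCompact (U : Set (BigHeckeGLn.FiniteAdelicGL 2 K)) →
          ∀ (A : Rep ℤ (U.comap (BigHeckeGLn.globalEmbedding 2 K))), Finite A →
            ∀ q : ℕ, 2 < q → Subsingleton (groupCohomology A q) := fun h =>
  not_subsingleton_iff_nontrivial.2 (nontrivial_groupCohomology_glIntegers_cyclotomicField_three 3)
    (h (CyclotomicField 3 ℚ) finrank_cyclotomicField_three isTotallyComplex_cyclotomicField_three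
      (glFiniteIntegralLevel 2 _) (isOpen_glFiniteIntegralLevel 2 _)
      (isCompact_glFiniteIntegralLevel_holds 2 _) (Rep.trivial ℤ _ (ZMod 2))
      (inferInstanceAs (Finite (ZMod 2))) 3 (by norm_num))

/-- **No eventual vanishing (`Γ_U` is not of finite cohomological dimension).**  The
strengthening of `BianchiCongruenceCohomologyFinite` asking that `H^q(Γ_U, A)` vanish for all
sufficiently large `q` is FALSE: at `K = ℚ(ζ₃)`, `U = GL₂(𝒪̂_K)`, `A = ℤ/2` trivial,
`H^q(GL₂(𝓞_K), ℤ/2) ≠ 0` for EVERY `q`.  Hence no projective `ℤ[Γ_U]`-resolution of `ℤ` of finite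
length exists for `Γ_U = GL₂(𝓞_K)`; finite-type resolutions live on torsion-free finite-index
subgroups only, and the crux must be reached by finite-index ascent. [folklore] -/
theorem not_bianchiCongruenceCohomology_eventually_subsingleton :
    ¬ ∀ (K : Type) [Field K] [NumberField K], Module.finrank ℚ K = 2 → IsTotallyComplex K →
        ∀ (U : Subgroup (BigHeckeGLn.FiniteAdelicGL 2 K)),
          IsOpen (U : Set (BigHeckeGLn.FiniteAdelicGL 2 K)) →
          IsCompact (U : Set (BigHeckeGLn.FiniteAdelicGL 2 K)) →
          ∀ (A : Rep ℤ (U.comap (BigHeckeGLn.globalEmbedding 2 K))), Finite A →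
            ∃ q₀ : ℕ, ∀ q : ℕ, q₀ ≤ q → Subsingleton (groupCohomology A q) := fun h => by
  obtain ⟨q₀, hq₀⟩ := h (CyclotomicField 3 ℚ) finrank_cyclotomicField_three
    isTotallyComplex_cyclotomicField_three (glFiniteIntegralLevel 2 _)
    (isOpen_glFiniteIntegralLevel 2 _) (isCompact_glFiniteIntegralLevel_holds 2 _)
    (Rep.trivial ℤ _ (ZMod 2)) (inferInstanceAs (Finite (ZMod 2)))
  exact not_subsingleton_iff_nontrivial.2
    (nontrivial_groupCohomology_glIntegers_cyclotomicField_three q₀) (hq₀ q₀ le_rfl)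

end Summit.Langlands.Langlands.Theorems.BianchiCongruenceCohomologyFinite.Negative

end
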